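import Literature.MathematicalPhysics.KineticTheory.CollisionTubeVarianceStaticsGeneral
import HarnessLib

/-!
# The collision-tube functional at rung 0: the variance of the decorated tube sum for general marks, SHARP in the window
# (kind proof, input of the rung-0 floor `stub_staticOpacityFloorRung0` of `JParityClosure.RateFloor`, stmt-AtomisticToContinuum-13080)

Constant profiles, `N + 1` spheres of diameter `ε = ε_N` on `𝕋³`, the product law `P_N ⊗ γ^{⊗(N+1)}`
(`P_N = posGibbsMeasure 1 ε (N+1)`), a measurable mark `|Ξ| ≤ C` vanishing at relative speed `≥ 2L` and a flight-time
window `κ ≥ 0`.  `CollisionTubeVarianceStaticsGeneral.variance_prod_decoratedTubeSum_le_of_bound` bounds the variance of the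
decorated tube sum `S(x, v) = Σ_{i≠j} h(xᵢ) pairTubeMark_{ij}` with the BALL volume `(4π/3)(ε(1+2Lκ))³` in place of the volume of
the near-contact shell, and with the SURE packing bound `(3+4Lκ)⁶ (N+1)` for the velocity part; both are too crude when the window
is short (`κ → 0`, the windows `Δ_N = A (N+1)^{-b}`, `b > 1/3`, of the RateFloor line).  Here:

* `volume_real_torusShell_le_sub` — the Haar volume of the torus shell `{ε < ‖reprSym d‖ ≤ R}` is at most
  `(4π/3)(R³ − ε³)` (`0 ≤ ε ≤ R < 1/2`), i.e. `≍ ε³ κ` for `R = ε(1 + 2Lκ)`, `κ → 0`;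
* `variance_pi_decoratedTubeSum_le_shellCount` — at fixed non-overlapping positions the velocity variance is at most
  `8 C² (3+4Lκ)³ Σ_m shellCount_m(x)` (bounded differences `c_m = 4C shellCount_m`, ONE factor bounded by packing);
* `integral_sum_shellCount_le` — `∫ Σ_m shellCount_m dP_N ≤ 4 (N+1)² vol(shell)` (`posGibbs_real_pairEvent_le`);
* `variance_prod_decoratedTubeSum_le_sharp` — law of total variance:
  `Var(S) ≤ 64 C² (3+4Lκ)³ (N+1)² v + 2 (N+1)² (16 C² v + 96 (N+1) C² v² + 4 ζ (N+1)² C² v²)`,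
  `v = (4π/3)((ε(1+2Lκ))³ − ε³)`, GIVEN the decorated pair-pair decorrelation of `P_N` at level `ζ` (Plateau′).
  Against the squared mean `≍ ((N+1) N ε³ κ)²` every term is now `o(1)` or `O(ζ)` uniformly in the window exponent
  `b ∈ [1/3, 1]`.

References: C. Cercignani, R. Illner, M. Pulvirenti (1994) §2.2 [CIPDiluteGases1994]; D. Ruelle (1969) §4.2 [Ruelle1969];
H. Spohn (1991) Part I §2.3 [Spohn1991].
-/

noncomputable section

namespace Literature.MathematicalPhysics.KineticTheory

open MeasureTheory ProbabilityTheory Set Filter Function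
open scoped ENNReal InnerProductSpace BigOperators
open Literature.Analysis.FluidPDE Literature.Probability.Moments

/-! ## The Haar volume of the torus shell, sharp form -/

/-- **Haar volume of the torus shell, sharp form**: `vol{ε < ‖reprSym d‖ ≤ R} ≤ (4π/3)(R³ − ε³)` for
`0 ≤ ε ≤ R < 1/2` (difference of two minimal-image balls, `Torus.volume_euclidDist_le`). [folklore] -/
theorem volume_real_torusShell_le_sub {ε R : ℝ} (hε : 0 ≤ ε) (hεR : ε ≤ R) (hR : R < 1 / 2) :
    (volume {d : T3 | ε < ‖Torus.reprSym d‖ ∧ ‖Torus.reprSym d‖ ≤ R}).toReal ≤ 4 / 3 * Real.pi * (R ^ 3 - ε ^ 3) := by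
  have hball : ∀ {s : ℝ}, 0 ≤ s → s < 1 / 2 →
      volume {d : T3 | Torus.euclidDist d 0 ≤ s} = ENNReal.ofReal (4 / 3 * Real.pi * s ^ 3) := fun {s} hs0 hs => by
    rw [Torus.volume_euclidDist_le hs, EuclideanSpace.volume_closedBall_fin_three, ← ENNReal.ofReal_pow hs0,
      ← ENNReal.ofReal_mul (by positivity)]
    congr 1; ring
  have hsub : {d : T3 | ε < ‖Torus.reprSym d‖ ∧ ‖Torus.reprSym d‖ ≤ R} ⊆
      {d : T3 | Torus.euclidDist d 0 ≤ R} \ {d : T3 | Torus.euclidDist d 0 ≤ ε} := fun d hd => by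
    simp only [Set.mem_sdiff, mem_setOf_eq, Torus.euclidDist_eq, sub_zero, not_le]
    exact ⟨hd.2, hd.1⟩
  have hmeasε : MeasurableSet {d : T3 | Torus.euclidDist d 0 ≤ ε} := by
    have : {d : T3 | Torus.euclidDist d 0 ≤ ε} = {d : T3 | ‖Torus.reprSym d‖ ≤ ε} := by
      ext d; simp only [mem_setOf_eq, Torus.euclidDist_eq, sub_zero]
    rw [this]; exact measurableSet_le Torus.measurable_reprSym.norm measurable_const
  have hinc : {d : T3 | Torus.euclidDist d 0 ≤ ε} ⊆ {d : T3 | Torus.euclidDist d 0 ≤ R} := fun d hd => by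
    simp only [mem_setOf_eq] at hd ⊢; exact hd.trans hεR
  have hεlt : ε < 1 / 2 := hεR.trans_lt hR
  have hR0 : 0 ≤ R := hε.trans hεR
  have hdiff : volume ({d : T3 | Torus.euclidDist d 0 ≤ R} \ {d : T3 | Torus.euclidDist d 0 ≤ ε}) =
      ENNReal.ofReal (4 / 3 * Real.pi * R ^ 3) - ENNReal.ofReal (4 / 3 * Real.pi * ε ^ 3) := by
    rw [measure_sdiff hinc hmeasε.nullMeasurableSet (by rw [hball hε hεlt]; exact ENNReal.ofReal_ne_top),
      hball hR0 hR, hball hε hεlt]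
  have hp3 : ε ^ 3 ≤ R ^ 3 := pow_le_pow_left₀ hε hεR 3
  have hle3 : 4 / 3 * Real.pi * ε ^ 3 ≤ 4 / 3 * Real.pi * R ^ 3 := mul_le_mul_of_nonneg_left hp3 (by positivity)
  calc (volume {d : T3 | ε < ‖Torus.reprSym d‖ ∧ ‖Torus.reprSym d‖ ≤ R}).toReal
      ≤ (volume ({d : T3 | Torus.euclidDist d 0 ≤ R} \ {d : T3 | Torus.euclidDist d 0 ≤ ε})).toReal :=
        ENNReal.toReal_mono (by rw [hdiff]; exact ENNReal.sub_ne_top ENNReal.ofReal_ne_top) (measure_mono hsub)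
    _ = 4 / 3 * Real.pi * (R ^ 3 - ε ^ 3) := by
        rw [hdiff, ← ENNReal.ofReal_sub _ (by positivity), ENNReal.toReal_ofReal (by linarith)]
        ring

/-- The shell volume at `R = ε(1 + 2Lκ)`: `≤ (4π/3)((ε(1+2Lκ))³ − ε³)` (`ε ≥ 0`, `L, κ ≥ 0`, `ε(1+2Lκ) < 1/2`). [folklore] -/
theorem volume_real_torusShell_window_le {ε L κ : ℝ} (hε : 0 ≤ ε) (hL : 0 ≤ L) (hκ : 0 ≤ κ)
    (hεL : ε * (1 + 2 * L * κ) < 1 / 2) :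
    (volume {d : T3 | ε < ‖Torus.reprSym d‖ ∧ ‖Torus.reprSym d‖ ≤ ε * (1 + 2 * L * κ)}).toReal ≤
      4 / 3 * Real.pi * ((ε * (1 + 2 * L * κ)) ^ 3 - ε ^ 3) := by
  refine volume_real_torusShell_le_sub hε ?_ hεL
  have : 0 ≤ ε * (2 * L * κ) := mul_nonneg hε (by positivity)
  nlinarith

/-! ## The velocity variance at fixed positions, with one packing factor only -/

/-- **Velocity variance of the decorated tube sum at fixed non-overlapping positions, shell-count form**:
`Var_v(S(x, ·)) ≤ 8 C² (3 + 4Lκ)³ Σ_m shellCount_m(x)` under any product law `γ^{⊗(N+1)}` (bounded differences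
`c_m = 4C shellCount_m`, `c_m² ≤ 16 C² (3+4Lκ)³ shellCount_m` by packing). [folklore] -/
theorem variance_pi_decoratedTubeSum_le_shellCount {σ : ℝ} (hσ : 0 < σ) {N : ℕ} {Ξ : V3 × V3 × V3 → ℝ} (hΞm : Measurable Ξ)
    {C L κ : ℝ} (hC : ∀ p, |Ξ p| ≤ C) (hL : 0 ≤ L) (hκ : 0 ≤ κ) (hΞL : ∀ m v v' : V3, 2 * L ≤ ‖v - v'‖ → Ξ (m, v, v') = 0)
    {h : T3 → ℝ} (hh1 : ∀ y, |h y| ≤ 1) (γ : Measure V3) [IsProbabilityMeasure γ]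
    {x : Fin (N + 1) → T3} (hx : x ∈ posDomain (hsDiameter σ N) (N + 1)) :
    variance (fun v => ∑ i, ∑ j, if i ≠ j then h (x i) * pairTubeMark (hsDiameter σ N) κ Ξ i j x v else 0)
      (Measure.pi fun _ : Fin (N + 1) => γ) ≤
      8 * C ^ 2 * (3 + 4 * L * κ) ^ 3 * ∑ m, shellCount σ N L κ (zipConfig (x, fun _ => (0 : V3))) m := by
  have hε := hsDiameter_pos hσ N
  have hC0 : 0 ≤ C := (abs_nonneg _).trans (hC (0, 0, 0))
  set g : (Fin (N + 1) → V3) → ℝ := fun v => ∑ i, ∑ j, if i ≠ j then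
    h (x i) * pairTubeMark (hsDiameter σ N) κ Ξ i j x v else 0 with hg
  have hgm : Measurable g := Finset.measurable_sum _ fun i _ => Finset.measurable_sum _ fun j _ =>
    measurable_decoratedTubeTerm _ κ hΞm h x i j
  have hterm : ∀ v i j, |(if i ≠ j then h (x i) * pairTubeMark (hsDiameter σ N) κ Ξ i j x v else 0)| ≤ C := fun v i j => by
    split_ifs
    · rw [abs_mul]
      exact (mul_le_mul (hh1 _) (abs_pairTubeMark_le _ κ hC i j x v) (abs_nonneg _) zero_le_one).trans_eq (one_mul _)
    · rw [abs_zero]; exact hC0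
  have hgb : ∀ v, |g v| ≤ (N + 1 : ℕ) * ((N + 1 : ℕ) * C) := fun v => by
    refine (Finset.abs_sum_le_sum_abs _ _).trans ?_
    calc ∑ i, |∑ j, (if i ≠ j then h (x i) * pairTubeMark (hsDiameter σ N) κ Ξ i j x v else 0)|
        ≤ ∑ _i : Fin (N + 1), ((N + 1 : ℕ) * C) := Finset.sum_le_sum fun i _ =>
          (Finset.abs_sum_le_sum_abs _ _).trans ((Finset.sum_le_sum fun j _ => hterm v i j).trans (by
            rw [Finset.sum_const, Finset.card_univ, Fintype.card_fin, nsmul_eq_mul]))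
      _ = (N + 1 : ℕ) * ((N + 1 : ℕ) * C) := by
          rw [Finset.sum_const, Finset.card_univ, Fintype.card_fin, nsmul_eq_mul]
  set c : Fin (N + 1) → ℝ := fun m => 4 * C * shellCount σ N L κ (zipConfig (x, fun _ => (0 : V3))) m with hc
  have hdiff : ∀ m v y, |g v - g (update v m y)| ≤ c m := fun m v y => by
    have h0 := abs_decoratedTubeSum_sub_update_le_of_bound hσ hC hκ hΞL hh1 x v m y
    have hsc : shellCount σ N L κ (zipConfig (x, v)) m = shellCount σ N L κ (zipConfig (x, fun _ => (0 : V3))) m := rfl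
    rw [hsc] at h0
    exact h0
  have hvar := variance_le_of_bounded_differences (fun _ : Fin (N + 1) => γ) hgm hgb hdiff
  have hCm : ∀ m, c m ^ 2 ≤ 16 * C ^ 2 * (3 + 4 * L * κ) ^ 3 * shellCount σ N L κ (zipConfig (x, fun _ => (0 : V3))) m :=
    fun m => by
    have hs0 : 0 ≤ shellCount σ N L κ (zipConfig (x, fun _ => (0 : V3))) m :=
      Finset.sum_nonneg fun b _ => shellInd_nonneg L κ _ m b
    have hs3 : shellCount σ N L κ (zipConfig (x, fun _ => (0 : V3))) m ≤ (3 + 4 * L * κ) ^ 3 :=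
      shellCount_zipConfig_le_cube hε (mul_nonneg hL hκ) hx _ m
    have e : c m ^ 2 = 16 * C ^ 2 * shellCount σ N L κ (zipConfig (x, fun _ => (0 : V3))) m *
        shellCount σ N L κ (zipConfig (x, fun _ => (0 : V3))) m := by
      simp only [hc]; ring
    rw [e]
    calc 16 * C ^ 2 * shellCount σ N L κ (zipConfig (x, fun _ => (0 : V3))) m *
          shellCount σ N L κ (zipConfig (x, fun _ => (0 : V3))) m
        ≤ 16 * C ^ 2 * shellCount σ N L κ (zipConfig (x, fun _ => (0 : V3))) m * (3 + 4 * L * κ) ^ 3 :=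
          mul_le_mul_of_nonneg_left hs3 (mul_nonneg (by positivity) hs0)
      _ = 16 * C ^ 2 * (3 + 4 * L * κ) ^ 3 * shellCount σ N L κ (zipConfig (x, fun _ => (0 : V3))) m := by ring
  calc variance g (Measure.pi fun _ : Fin (N + 1) => γ) ≤ (1 / 2 : ℝ) * ∑ m, c m ^ 2 := hvar
    _ ≤ (1 / 2 : ℝ) * ∑ m, 16 * C ^ 2 * (3 + 4 * L * κ) ^ 3 * shellCount σ N L κ (zipConfig (x, fun _ => (0 : V3))) m :=
        mul_le_mul_of_nonneg_left (Finset.sum_le_sum fun m _ => hCm m) (by norm_num)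
    _ = 8 * C ^ 2 * (3 + 4 * L * κ) ^ 3 * ∑ m, shellCount σ N L κ (zipConfig (x, fun _ => (0 : V3))) m := by
        rw [← Finset.mul_sum]; ring

/-! ## The mean shell count under the canonical measure -/

/-- The shell indicator of a zipped configuration is the indicator of the pair event `x_m − x_l ∈ shell`. [folklore] -/
theorem shellInd_zipConfig_eq_indicator {σ : ℝ} {N : ℕ} (L κ : ℝ) (x : Fin (N + 1) → T3) (v : Fin (N + 1) → V3)
    (m l : Fin (N + 1)) :
    shellInd σ N L κ (zipConfig (x, v)) m l =
      {x : Fin (N + 1) → T3 | x m - x l ∈ {d : T3 | hsDiameter σ N < ‖Torus.reprSym d‖ ∧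
        ‖Torus.reprSym d‖ ≤ hsDiameter σ N * (1 + 2 * L * κ)}}.indicator (fun _ => (1 : ℝ)) x := by
  simp only [shellInd, sepAt, zipConfig_apply, Torus.geometry_sepVec, Set.indicator_apply, mem_setOf_eq]
  split_ifs <;> rfl

/-- The shell indicator is at most `1`. [folklore] -/
theorem shellInd_le_one {σ : ℝ} {N : ℕ} (L κ : ℝ) (ζ : Config (N + 1) (Fin 3) T3) (i j : Fin (N + 1)) :
    shellInd σ N L κ ζ i j ≤ 1 := by
  unfold shellInd; split_ifs <;> norm_num

/-- The diagonal shell indicator vanishes (`ε > 0`). [folklore] -/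
theorem shellInd_self {σ : ℝ} (hσ : 0 < σ) {N : ℕ} (L κ : ℝ) (ζ : Config (N + 1) (Fin 3) T3) (m : Fin (N + 1)) :
    shellInd σ N L κ ζ m m = 0 := by
  have hε := hsDiameter_pos hσ N
  unfold shellInd sepAt
  rw [if_neg]
  rintro ⟨h1, -⟩
  rw [Torus.geometry_sepVec, sub_self, Torus.reprSym_zero, norm_zero] at h1
  exact lt_irrefl _ (hε.trans h1)

/-- **Mean total shell count**: `∫ Σ_m shellCount_m dP_N ≤ 4 (N+1)² vol(shell)` at small density, `N ≥ 1`
(`posGibbs_real_pairEvent_le` off the diagonal, `shellInd_self` on it). [folklore] -/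
theorem integral_sum_shellCount_le {σ : ℝ} (hsd : SmallDensity uniformProfile σ) {N : ℕ} (hN : 1 ≤ N) (L κ : ℝ) :
    ∫ x, (∑ m, shellCount σ N L κ (zipConfig (x, fun _ => (0 : V3))) m)
        ∂posGibbsMeasure (fun _ : T3 => (1 : ℝ)) (hsDiameter σ N) (N + 1) ≤
      ((N + 1 : ℕ) : ℝ) ^ 2 * (4 * (volume {d : T3 | hsDiameter σ N < ‖Torus.reprSym d‖ ∧
        ‖Torus.reprSym d‖ ≤ hsDiameter σ N * (1 + 2 * L * κ)}).toReal) := by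
  have hσ := hsd.σ_pos
  haveI := isProbabilityMeasure_posGibbsMeasure continuous_const (fun _ => one_pos) hsd.σ_lt_half.le N
  set P := posGibbsMeasure (fun _ : T3 => (1 : ℝ)) (hsDiameter σ N) (N + 1) with hP
  set D : Set T3 := {d : T3 | hsDiameter σ N < ‖Torus.reprSym d‖ ∧ ‖Torus.reprSym d‖ ≤ hsDiameter σ N * (1 + 2 * L * κ)}
    with hD
  have hDm : MeasurableSet D := measurableSet_torusShell _ _
  have hEm : ∀ m l : Fin (N + 1), MeasurableSet {x : Fin (N + 1) → T3 | x m - x l ∈ D} := fun m l =>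
    hDm.preimage ((measurable_pi_apply m).sub (measurable_pi_apply l))
  have hind : ∀ (m l : Fin (N + 1)) (x : Fin (N + 1) → T3), shellInd σ N L κ (zipConfig (x, fun _ => (0 : V3))) m l =
      {x : Fin (N + 1) → T3 | x m - x l ∈ D}.indicator (fun _ => (1 : ℝ)) x := fun m l x =>
    shellInd_zipConfig_eq_indicator L κ x _ m l
  have hint : ∀ m l : Fin (N + 1), Integrable (fun x : Fin (N + 1) → T3 =>
      shellInd σ N L κ (zipConfig (x, fun _ => (0 : V3))) m l) P := fun m l => by
    simp_rw [hind m l]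
    exact (integrable_const (1 : ℝ)).indicator (hEm m l)
  have hpair : ∀ m l : Fin (N + 1), ∫ x, shellInd σ N L κ (zipConfig (x, fun _ => (0 : V3))) m l ∂P ≤
      4 * (volume D).toReal := fun m l => by
    by_cases hml : m = l
    · subst hml
      simp_rw [shellInd_self hσ L κ]
      rw [integral_zero]
      positivity
    · simp_rw [hind m l]
      rw [integral_indicator (hEm m l), setIntegral_const, smul_eq_mul, mul_one]
      exact posGibbs_real_pairEvent_le hsd hN hml hDm
  calc ∫ x, (∑ m, shellCount σ N L κ (zipConfig (x, fun _ => (0 : V3))) m) ∂P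
      = ∑ m, ∑ l, ∫ x, shellInd σ N L κ (zipConfig (x, fun _ => (0 : V3))) m l ∂P := by
        simp only [shellCount]
        rw [integral_finsetSum _ fun m _ => integrable_finsetSum _ fun l _ => hint m l]
        exact Finset.sum_congr rfl fun m _ => integral_finsetSum _ fun l _ => hint m l
    _ ≤ ∑ _m : Fin (N + 1), ∑ _l : Fin (N + 1), 4 * (volume D).toReal :=
        Finset.sum_le_sum fun m _ => Finset.sum_le_sum fun l _ => hpair m l
    _ = ((N + 1 : ℕ) : ℝ) ^ 2 * (4 * (volume D).toReal) := by
        rw [Finset.sum_const, Finset.card_univ, Fintype.card_fin, nsmul_eq_mul, Finset.sum_const, Finset.card_univ,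
          Fintype.card_fin, nsmul_eq_mul]
        ring

/-! ## The variance on the product space, sharp form -/

/-- **Variance of the decorated tube sum under `P_N ⊗ γ^{⊗(N+1)}`, sharp in the window** (small density, `N ≥ 1`, measurable
`|Ξ| ≤ C`, `0 < C`, vanishing at relative speed `≥ 2L`, `0 ≤ L`, `0 ≤ κ`, `ε(1 + 2Lκ) < 1/2`, `|h| ≤ 1` measurable, probability
law `γ`), GIVEN the decorated pair-pair decorrelation bound at level `ζ`: with `v = (4π/3)((ε(1 + 2Lκ))³ − ε³)` the volume of
the ball difference containing the near-contact shell,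
`Var(S) ≤ 64 C² (3 + 4Lκ)³ (N+1)² v + 2 (N+1)² (16 C² v + 96 (N+1) C² v² + 4 ζ (N+1)² C² v²)`
(law of total variance; `variance_pi_decoratedTubeSum_le_shellCount` + `integral_sum_shellCount_le` for the velocity part,
`variance_decoratedPairSum_le` with the shell as support for the position part). [folklore] -/
theorem variance_prod_decoratedTubeSum_le_sharp {σ : ℝ} (hsd : SmallDensity uniformProfile σ) {N : ℕ} (hN : 1 ≤ N)
    {Ξ : V3 × V3 × V3 → ℝ} (hΞm : Measurable Ξ) {C L κ : ℝ} (hCpos : 0 < C) (hC : ∀ p, |Ξ p| ≤ C) (hL : 0 ≤ L) (hκ : 0 ≤ κ)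
    (hΞL : ∀ m v v' : V3, 2 * L ≤ ‖v - v'‖ → Ξ (m, v, v') = 0) (hεL : hsDiameter σ N * (1 + 2 * L * κ) < 1 / 2)
    {h : T3 → ℝ} (hh : Measurable h) (hh1 : ∀ y, |h y| ≤ 1) (γ : Measure V3) [IsProbabilityMeasure γ]
    {ζ : ℝ} (hζ : 0 ≤ ζ)
    (hdec : ∀ i j i' j' : Fin (N + 1), i ≠ j → i ≠ i' → i ≠ j' → j ≠ i' → j ≠ j' → i' ≠ j' →
      ∀ T T' : Set T3, MeasurableSet T → MeasurableSet T' →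
      |(∫ x, h (x i) * T.indicator (fun _ => (1 : ℝ)) (x j - x i) * (h (x i') * T'.indicator (fun _ => (1 : ℝ)) (x j' - x i'))
          ∂posGibbsMeasure (fun _ : T3 => (1 : ℝ)) (hsDiameter σ N) (N + 1)) -
        (∫ x, h (x i) * T.indicator (fun _ => (1 : ℝ)) (x j - x i) ∂posGibbsMeasure (fun _ : T3 => (1 : ℝ)) (hsDiameter σ N) (N + 1)) *
        (∫ x, h (x i') * T'.indicator (fun _ => (1 : ℝ)) (x j' - x i') ∂posGibbsMeasure (fun _ : T3 => (1 : ℝ)) (hsDiameter σ N) (N + 1))|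
        ≤ ζ * (volume T).toReal * (volume T').toReal) :
    variance (fun p : (Fin (N + 1) → T3) × (Fin (N + 1) → V3) =>
        ∑ i, ∑ j, if i ≠ j then h (p.1 i) * pairTubeMark (hsDiameter σ N) κ Ξ i j p.1 p.2 else 0)
      ((posGibbsMeasure (fun _ : T3 => (1 : ℝ)) (hsDiameter σ N) (N + 1)).prod (Measure.pi fun _ : Fin (N + 1) => γ)) ≤
      64 * C ^ 2 * (3 + 4 * L * κ) ^ 3 * ((N + 1 : ℕ) : ℝ) ^ 2 *
          (4 / 3 * Real.pi * ((hsDiameter σ N * (1 + 2 * L * κ)) ^ 3 - hsDiameter σ N ^ 3)) +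
        2 * (((N + 1 : ℕ) : ℝ) ^ 2 * (16 * C ^ 2 * (4 / 3 * Real.pi * ((hsDiameter σ N * (1 + 2 * L * κ)) ^ 3 - hsDiameter σ N ^ 3)) +
          96 * ((N + 1 : ℕ) : ℝ) * C ^ 2 * (4 / 3 * Real.pi * ((hsDiameter σ N * (1 + 2 * L * κ)) ^ 3 - hsDiameter σ N ^ 3)) ^ 2 +
          4 * ζ * ((N + 1 : ℕ) : ℝ) ^ 2 * C ^ 2 *
            (4 / 3 * Real.pi * ((hsDiameter σ N * (1 + 2 * L * κ)) ^ 3 - hsDiameter σ N ^ 3)) ^ 2)) := by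
  have hσ := hsd.σ_pos
  have hε := hsDiameter_pos hσ N
  haveI := isProbabilityMeasure_posGibbsMeasure continuous_const (fun _ => one_pos) hsd.σ_lt_half.le N
  set P := posGibbsMeasure (fun _ : T3 => (1 : ℝ)) (hsDiameter σ N) (N + 1) with hP
  set Q : Measure (Fin (N + 1) → V3) := Measure.pi fun _ : Fin (N + 1) => γ with hQ
  set vS : ℝ := 4 / 3 * Real.pi * ((hsDiameter σ N * (1 + 2 * L * κ)) ^ 3 - hsDiameter σ N ^ 3) with hvS
  set S : (Fin (N + 1) → T3) × (Fin (N + 1) → V3) → ℝ := fun p =>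
    ∑ i, ∑ j, if i ≠ j then h (p.1 i) * pairTubeMark (hsDiameter σ N) κ Ξ i j p.1 p.2 else 0 with hS
  have hSm : Measurable S := measurable_decoratedTubeSum (hsDiameter σ N) κ hΞm hh
  have hC0 : 0 ≤ C := hCpos.le
  have hterm : ∀ (p : (Fin (N + 1) → T3) × (Fin (N + 1) → V3)) i j,
      |(if i ≠ j then h (p.1 i) * pairTubeMark (hsDiameter σ N) κ Ξ i j p.1 p.2 else 0)| ≤ C := fun p i j => by
    split_ifs
    · rw [abs_mul]
      exact (mul_le_mul (hh1 _) (abs_pairTubeMark_le _ κ hC i j p.1 p.2) (abs_nonneg _) zero_le_one).trans_eq (one_mul _)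
    · rw [abs_zero]; exact hC0
  have hSb : ∀ p, |S p| ≤ (N + 1 : ℕ) * ((N + 1 : ℕ) * C) := fun p => by
    refine (Finset.abs_sum_le_sum_abs _ _).trans ?_
    calc ∑ i, |∑ j, (if i ≠ j then h (p.1 i) * pairTubeMark (hsDiameter σ N) κ Ξ i j p.1 p.2 else 0)|
        ≤ ∑ _i : Fin (N + 1), ((N + 1 : ℕ) * C) := Finset.sum_le_sum fun i _ =>
          (Finset.abs_sum_le_sum_abs _ _).trans ((Finset.sum_le_sum fun j _ => hterm p i j).trans (by
            rw [Finset.sum_const, Finset.card_univ, Fintype.card_fin, nsmul_eq_mul]))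
      _ = (N + 1 : ℕ) * ((N + 1 : ℕ) * C) := by
          rw [Finset.sum_const, Finset.card_univ, Fintype.card_fin, nsmul_eq_mul]
  -- law of total variance
  have hsplit := variance_prod_le P Q hSm hSb
  -- the shell and its volume
  set D : Set T3 := {d : T3 | hsDiameter σ N < ‖Torus.reprSym d‖ ∧ ‖Torus.reprSym d‖ ≤ hsDiameter σ N * (1 + 2 * L * κ)}
    with hD
  have hv : (volume D).toReal ≤ vS := volume_real_torusShell_window_le hε.le hL hκ hεL
  have hv0 : 0 ≤ (volume D).toReal := ENNReal.toReal_nonneg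
  -- (i) the velocity variance, integrated over the positions
  have h1 : ∫ x, variance (fun v => S (x, v)) Q ∂P ≤ 32 * C ^ 2 * (3 + 4 * L * κ) ^ 3 * ((N + 1 : ℕ) : ℝ) ^ 2 * vS := by
    have hae : ∀ᵐ x ∂P, variance (fun v => S (x, v)) Q ≤
        8 * C ^ 2 * (3 + 4 * L * κ) ^ 3 * ∑ m, shellCount σ N L κ (zipConfig (x, fun _ => (0 : V3))) m := by
      filter_upwards [ae_mem_posDomain (fun _ : T3 => (1 : ℝ)) (hsDiameter σ N) (N + 1)] with x hx
      exact variance_pi_decoratedTubeSum_le_shellCount hσ hΞm hC hL hκ hΞL hh1 γ hx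
    have hscm : Measurable fun x : Fin (N + 1) → T3 => ∑ m, shellCount σ N L κ (zipConfig (x, fun _ => (0 : V3))) m := by
      refine Finset.measurable_sum _ fun m _ => Finset.measurable_sum _ fun l _ => ?_
      simp_rw [shellInd_zipConfig_eq_indicator L κ _ (fun _ => (0 : V3)) m l]
      exact measurable_const.indicator
        ((measurableSet_torusShell _ _).preimage ((measurable_pi_apply m).sub (measurable_pi_apply l)))
    have hscb : ∀ x : Fin (N + 1) → T3, |∑ m, shellCount σ N L κ (zipConfig (x, fun _ => (0 : V3))) m| ≤
        (N + 1 : ℕ) * ((N + 1 : ℕ) * (1 : ℝ)) := fun x => by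
      have h0 : 0 ≤ ∑ m, shellCount σ N L κ (zipConfig (x, fun _ => (0 : V3))) m :=
        Finset.sum_nonneg fun m _ => Finset.sum_nonneg fun b _ => shellInd_nonneg L κ _ m b
      rw [abs_of_nonneg h0]
      calc ∑ m, shellCount σ N L κ (zipConfig (x, fun _ => (0 : V3))) m
          ≤ ∑ _m : Fin (N + 1), ((N + 1 : ℕ) * (1 : ℝ)) := Finset.sum_le_sum fun m _ => by
            unfold shellCount
            exact (Finset.sum_le_sum fun l _ => shellInd_le_one L κ _ m l).trans (by
              rw [Finset.sum_const, Finset.card_univ, Fintype.card_fin, nsmul_eq_mul])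
        _ = (N + 1 : ℕ) * ((N + 1 : ℕ) * (1 : ℝ)) := by
            rw [Finset.sum_const, Finset.card_univ, Fintype.card_fin, nsmul_eq_mul]
    have hsci : Integrable (fun x : Fin (N + 1) → T3 =>
        8 * C ^ 2 * (3 + 4 * L * κ) ^ 3 * ∑ m, shellCount σ N L κ (zipConfig (x, fun _ => (0 : V3))) m) P :=
      (Integrable.of_bound hscm.aestronglyMeasurable _
        (ae_of_all _ fun x => (Real.norm_eq_abs _).trans_le (hscb x))).const_mul _
    calc ∫ x, variance (fun v => S (x, v)) Q ∂P
        ≤ ∫ x, 8 * C ^ 2 * (3 + 4 * L * κ) ^ 3 * ∑ m, shellCount σ N L κ (zipConfig (x, fun _ => (0 : V3))) m ∂P :=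
          integral_mono_of_nonneg (ae_of_all _ fun x => variance_nonneg _ _) hsci hae
      _ = 8 * C ^ 2 * (3 + 4 * L * κ) ^ 3 * ∫ x, (∑ m, shellCount σ N L κ (zipConfig (x, fun _ => (0 : V3))) m) ∂P :=
          integral_const_mul _ _
      _ ≤ 8 * C ^ 2 * (3 + 4 * L * κ) ^ 3 * (((N + 1 : ℕ) : ℝ) ^ 2 * (4 * (volume D).toReal)) :=
          mul_le_mul_of_nonneg_left (integral_sum_shellCount_le hsd hN L κ) (by positivity)
      _ ≤ 8 * C ^ 2 * (3 + 4 * L * κ) ^ 3 * (((N + 1 : ℕ) : ℝ) ^ 2 * (4 * vS)) := by gcongr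
      _ = 32 * C ^ 2 * (3 + 4 * L * κ) ^ 3 * ((N + 1 : ℕ) : ℝ) ^ 2 * vS := by ring
  -- (ii) the conditional mean is the decorated pair sum with the velocity-averaged tube mark
  set φ : T3 → ℝ := fun d => ∫ p, tubeMark κ Ξ ((hsDiameter σ N)⁻¹ • Torus.reprSym (-d)) p.1 p.2 ∂(γ.prod γ) with hφ
  have hmean : (fun x => ∫ v, S (x, v) ∂Q) = fun x => ∑ i, ∑ j, if i ≠ j then h (x i) * φ (x j - x i) else 0 := by
    funext x
    exact integral_pi_decoratedTubeSum (hsDiameter σ N) κ hΞm hC h γ x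
  have hφm : Measurable φ := measurable_velAvg_tubeMark (hsDiameter σ N) κ hΞm γ
  have hφB : ∀ d, |φ d| ≤ C := fun d => abs_velAvg_tubeMark_le_of_bound hC (hsDiameter σ N) κ γ d
  have hφD : ∀ d, φ d ≠ 0 → d ∈ D := fun d hd => mem_torusShell_of_velAvg_ne_zero_of_speedCutoff hκ hε hΞL γ d hd
  have hDm : MeasurableSet D := measurableSet_torusShell (hsDiameter σ N) _
  have hDs : ∀ d, d ∈ D ↔ -d ∈ D := fun d => mem_torusShell_iff_neg_mem (hsDiameter σ N) _ d
  have h2 := variance_decoratedPairSum_le hsd hN hh hh1 hφm hCpos hφB hDm hDs hφD hζ hdec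
  have h2' : variance (fun x => ∫ v, S (x, v) ∂Q) P ≤
      ((N + 1 : ℕ) : ℝ) ^ 2 * (16 * C ^ 2 * vS + 96 * ((N + 1 : ℕ) : ℝ) * C ^ 2 * vS ^ 2 +
        4 * ζ * ((N + 1 : ℕ) : ℝ) ^ 2 * C ^ 2 * vS ^ 2) := by
    rw [hmean]
    refine h2.trans ?_
    have hv2 : (volume D).toReal ^ 2 ≤ vS ^ 2 := pow_le_pow_left₀ hv0 hv 2
    have hn : (0 : ℝ) ≤ ((N + 1 : ℕ) : ℝ) := by positivity
    gcongr
  linarith [hsplit, h1, h2']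

end Literature.MathematicalPhysics.KineticTheory

end
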